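import Summits.Schanuel.Schanuel.Theorems.ZilberEacCriticalTargetsExistence
import Summits.Schanuel.Schanuel.Theorems.ZilberEacWeightedElimination
import Summits.Schanuel.Schanuel.Theorems.ZilberEacCriticalFibresDensity
import Mathlib.Algebra.MvPolynomial.Expand
import HarnessLib

/-!
# The critical size with TARGETS OF DEGREE `δ` and arbitrary fibre polynomials: Zariski density
# `{x₂ = r₀x₀ + (1/e - r₀)x₁ + c, y₀ = A₀(x₀,x₁) + y₂F₀(y₂), y₁ = A₁(x₀,x₁) + y₂F₁(y₂)}`

Zilber's Exponential-Algebraic Closedness, case ladder (host summit Schanuel, cell `pub-schanuel`,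
seat 2, gen 14).  THE FAMILY (`δ ≥ 1`; targets `A₀, A₁ ∈ ℂ[x₀,x₁]` of total degree `≤ δ` whose
degree-`δ` parts do not vanish on the diagonal, `Tⱼ = (Aⱼ)_δ(1,1) ≠ 0`, and with `x ↦ (A₀, A₁)`
dominant for cell membership; fibres `F₀ ≠ 0`, `deg F₁ ≤ deg F₀ = e - 1`; `r₀ ∉ ℚ`; `c ∈ ℂ`):

  `W = {x₂ = r₀x₀ + (1/e - r₀)x₁ + c,  y₀ = A₀(x) + y₂F₀(y₂),  y₁ = A₁(x) + y₂F₁(y₂)} ⊆ ℂ³ × ℂ³`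

— the critical size with targets of ANY degree (gen 13 / `ZilberEacCriticalFibresDensity`: targets
`Xⱼ`).  Along the diagonal rays with drift `δ` (`x = (2πiem + δ log m)(1,1) + ρ`) all three terms
have size `m^δ`; the coupled limit system `e^{ρⱼ} = Pⱼ + aⱼe^{K + αρ₀ + (1-α)ρ₁}` now has two
constants `Pⱼ = (2πie)^δ Tⱼ`.  It REDUCES TO THE ONE-CONSTANT SYSTEM of `ZilberEacCriticalFibresSupply`
by rescaling: with `ℓ₁ = log(P₁/P₀)`, `κ = (1-α)ℓ₁`, the solutions for `(P₀, P₀; a₀e^{κ}, a₁(P₀/P₁)e^{κ})`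
shifted by `(0, ℓ₁)` are solutions for `(P₀, P₁; a₀, a₁)`, non-degeneracy and the genericity data
(`‖ρ₁ - ρ₀‖ → ∞`, `e^{ρ₀} → T`) being preserved.  Existence: `exists_solutions_criticalTargets`;
elimination: THEOREM N₂^(δ) (`unprojectedDense_of_bddLinPow`) in the coordinates `(x₀, x₁, y₀)`,
`y₀/m^δ → e^{ρ₀*}`.

**THEOREM (`unprojectedDense_polyFibredGraph_critical_targets`).**  `I(W ∩ Γ_exp) = I(W)`.
`polyFibredGraph_critical_targets_member_dense` (with `A` dominant): all seven hypotheses of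
`ECCell 3 2`, not linearly split, `W ∩ Γ_exp ≠ ∅`, dense.  Example **`sqSqTargets_member_dense`**:
`{x₂ = √2x₀ + (1/2 - √2)x₁, y₀ = x₀² + y₂², y₁ = x₁² + 2y₂²}` ∈ EC(3,2), DENSE.

HONEST FRAMING: explicit families inside an OPEN cell (targets whose top parts vanish at `(1,1)`,
targets of different degrees, super-critical sizes stay open); `EC(3,2)` OPEN; NOT Schanuel's
conjecture; EAC ⇏ SC.
-/

noncomputable section

open Complex MvPolynomial Filter Topology
open Literature.NumberTheory.Transcendental Literature.ModelTheory.Zilber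
  Literature.ModelTheory.ExponentialFields

set_option linter.dupNamespace false

namespace Summit.Schanuel.Schanuel.Theorems

section TargetsDensity

/-- **THEOREM (Zariski density at critical size, targets of degree `δ`, arbitrary fibres).**  See the
module docstring. (new) [cite: MantovaMasser2023, §1 p.5 (the open case dim π(V) = 2 in ℂ³×ℂˣ³)] -/
theorem unprojectedDense_polyFibredGraph_critical_targets (δ : ℕ) (hδ : 1 ≤ δ)
    (Atar : Fin 2 → MvPolynomial (Fin 2) ℂ) (htot : ∀ j, (Atar j).totalDegree ≤ δ)
    (htop : ∀ j, (∑ n ∈ (Atar j).support, (if n 0 + n 1 = δ then coeff n (Atar j) else 0)) ≠ 0)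
    (F : Fin 2 → Polynomial ℂ) (hF0 : F 0 ≠ 0) (hdeg : (F 1).natDegree ≤ (F 0).natDegree)
    (r₀ : ℝ) (hr : Irrational r₀) (c : ℂ) :
    UnprojectedDense (polyFibredGraph
      (hyperplanePoly ![r₀, 1 / (((F 0).natDegree + 1 : ℕ) : ℝ) - r₀] c) Atar
      (fun j => (F j).toMvPolynomial 0)) := by
  classical
  have hπ := Real.pi_pos
  have h2πI : (2 * Real.pi * I : ℂ) ≠ 0 := Complex.two_pi_I_ne_zero
  set e : ℕ := (F 0).natDegree + 1 with hedef
  have he : 1 ≤ e := by omega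
  have he0 : e ≠ 0 := by omega
  have heC : (e : ℂ) ≠ 0 := by exact_mod_cast he0
  have heR : (e : ℝ) ≠ 0 := by exact_mod_cast he0
  have hdegj : ∀ j : Fin 2, (F j).natDegree < e := by
    intro j
    fin_cases j
    · simp only [Fin.zero_eta]; omega
    · simp only [Fin.mk_one]; omega
  -- leading data
  set a₀ : ℂ := (F 0).coeff (e - 1) with ha₀
  set a₁ : ℂ := (F 1).coeff (e - 1) with ha₁
  have ha₀0 : a₀ ≠ 0 := by
    rw [ha₀, hedef, Nat.add_sub_cancel, Polynomial.coeff_natDegree]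
    exact Polynomial.leadingCoeff_ne_zero.2 hF0
  set α : ℝ := (e : ℝ) * r₀ with hα
  have hαirr : Irrational α := by
    rw [hα]; simpa using hr.natCast_mul he0
  set K : ℂ := (e : ℂ) * c with hK
  -- the two constants `Pⱼ = (2πie)^δ Tⱼ`
  set P : Fin 2 → ℂ := fun j => (2 * Real.pi * I * (e : ℂ) * ((1 : ℤ) : ℂ)) ^ δ *
    ∑ n ∈ (Atar j).support, (if n 0 + n 1 = δ then coeff n (Atar j) else 0) with hPdef
  have hPne : ∀ j, P j ≠ 0 := by
    intro j
    refine mul_ne_zero (pow_ne_zero _ ?_) (htop j)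
    push_cast; rw [mul_one]; exact mul_ne_zero h2πI heC
  -- conversion between the `(α, K)` and the `(e, r₀, c)` forms of the exponent
  have hconv : ∀ ρ : ℂ × ℂ, K + (α : ℂ) * ρ.1 + (1 - (α : ℂ)) * ρ.2 =
      (e : ℂ) * (c + (r₀ : ℂ) * ρ.1 + ((1 / (e : ℝ) - r₀ : ℝ) : ℂ) * ρ.2) := by
    intro ρ
    rw [hK, hα]
    push_cast
    field_simp
  -- the rescaled one-constant supply
  have hq : P 1 / P 0 ≠ 0 := div_ne_zero (hPne 1) (hPne 0)
  set ℓ₁ : ℂ := log (P 1 / P 0) with hℓ₁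
  have hexpℓ₁ : exp ℓ₁ = P 1 / P 0 := Complex.exp_log hq
  set κ : ℂ := (1 - (α : ℂ)) * ℓ₁ with hκ
  set b₀ : ℂ := a₀ * exp κ with hb₀
  set b₁ : ℂ := a₁ * (P 0 / P 1) * exp κ with hb₁
  have hb₀0 : b₀ ≠ 0 := mul_ne_zero ha₀0 (Complex.exp_ne_zero _)
  obtain ⟨𝒯, h𝒯, hsup⟩ := exists_limitPairs_supply b₀ b₁ hb₀0 hαirr K (hPne 0)
  set PS : Set (ℂ × ℂ) := {vt | ∃ ρ : ℂ × ℂ,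
    exp ρ.1 = P 0 + a₀ * exp (K + (α : ℂ) * ρ.1 + (1 - (α : ℂ)) * ρ.2) ∧
    exp ρ.2 = P 1 + a₁ * exp (K + (α : ℂ) * ρ.1 + (1 - (α : ℂ)) * ρ.2) ∧
    (1 - (α : ℂ)) * P 1 * exp ρ.1 + α * P 0 * exp ρ.2 ≠ 0 ∧ vt = (ρ.2 - ρ.1, exp ρ.1)} with hPS
  have hgen : ∀ Q : MvPolynomial (Fin 2) ℂ, Q ≠ 0 → ∃ vt ∈ PS, eval ![vt.1, vt.2] Q ≠ 0 := by
    intro Q hQ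
    refine pairs_generic_of_limitSupply h𝒯 (PS := PS) (fun T hT => ?_) Q hQ
    obtain ⟨ρ, hev, hnorm, hlim⟩ := hsup T hT
    refine ⟨fun k => ((ρ k).2 + ℓ₁ - (ρ k).1, exp (ρ k).1), ?_, ?_, hlim⟩
    · filter_upwards [hev] with k hk
      obtain ⟨hk0, hk1, hkM⟩ := hk
      refine ⟨((ρ k).1, (ρ k).2 + ℓ₁), ?_, ?_, ?_, rfl⟩
      · -- `e^{ρ₀} = P₀ + a₀ e^{K + t + κ}`
        change exp (ρ k).1 = P 0 + a₀ * exp (K + (α : ℂ) * (ρ k).1 + (1 - (α : ℂ)) * ((ρ k).2 + ℓ₁))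
        have : K + (α : ℂ) * (ρ k).1 + (1 - (α : ℂ)) * ((ρ k).2 + ℓ₁) =
            (K + (α : ℂ) * (ρ k).1 + (1 - (α : ℂ)) * (ρ k).2) + κ := by rw [hκ]; ring
        rw [this, Complex.exp_add (K + (α : ℂ) * (ρ k).1 + (1 - (α : ℂ)) * (ρ k).2) κ, hk0, hb₀]
        ring
      · -- `e^{ρ₁ + ℓ₁} = (P₀ + b₁ e^{K+t}) P₁/P₀ = P₁ + a₁ e^{K + t + κ}`
        change exp ((ρ k).2 + ℓ₁) =
          P 1 + a₁ * exp (K + (α : ℂ) * (ρ k).1 + (1 - (α : ℂ)) * ((ρ k).2 + ℓ₁))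
        have hP0 := hPne 0
        have hP1 := hPne 1
        have : K + (α : ℂ) * (ρ k).1 + (1 - (α : ℂ)) * ((ρ k).2 + ℓ₁) =
            (K + (α : ℂ) * (ρ k).1 + (1 - (α : ℂ)) * (ρ k).2) + κ := by rw [hκ]; ring
        rw [this, Complex.exp_add (K + (α : ℂ) * (ρ k).1 + (1 - (α : ℂ)) * (ρ k).2) κ,
          Complex.exp_add (ρ k).2 ℓ₁, hk1, hexpℓ₁, hb₁]
        field_simp
      · -- non-degeneracy
        change (1 - (α : ℂ)) * P 1 * exp (ρ k).1 + (α : ℂ) * P 0 * exp ((ρ k).2 + ℓ₁) ≠ 0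
        rw [Complex.exp_add (ρ k).2 ℓ₁, hexpℓ₁]
        have hP0 := hPne 0
        have : (1 - (α : ℂ)) * P 1 * exp (ρ k).1 + (α : ℂ) * P 0 * (exp (ρ k).2 * (P 1 / P 0)) =
            P 1 * ((1 - (α : ℂ)) * exp (ρ k).1 + α * exp (ρ k).2) := by
          field_simp
        rw [this]
        exact mul_ne_zero (hPne 1) hkM
    · -- `‖ρ₁ + ℓ₁ - ρ₀‖ ≥ ‖ρ₁ - ρ₀‖ - ‖ℓ₁‖ → ∞`
      have hlow : ∀ k, ‖(ρ k).2 - (ρ k).1‖ - ‖ℓ₁‖ ≤ ‖(ρ k).2 + ℓ₁ - (ρ k).1‖ := by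
        intro k
        have e : (ρ k).2 + ℓ₁ - (ρ k).1 = ((ρ k).2 - (ρ k).1) + ℓ₁ := by ring
        rw [e]
        have h := norm_sub_le (((ρ k).2 - (ρ k).1) + ℓ₁) ℓ₁
        rw [add_sub_cancel_right] at h
        linarith
      refine tendsto_atTop_mono hlow ?_
      exact tendsto_atTop_add_const_right _ _ hnorm
  set r : Fin 2 → ℝ := ![r₀, 1 / (e : ℝ) - r₀] with hrdef
  refine unprojectedDense_of_bddLinPow (isIrreducibleClosed_polyFibredGraph _ _ _)
    (by rw [zariskiDim_polyFibredGraph]) ![Sum.inl 0, Sum.inl 1, Sum.inr 0] δ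
    (Wst := 2 * Real.pi * I * (e : ℂ)) (mul_ne_zero h2πI heC) hgen ?_
  rintro _ ⟨ρs, hl0, hl1, hnd, rfl⟩
  -- base solution in the form of the existence theorem
  have hPform : ∀ j, P j = (2 * Real.pi * I * (e : ℂ) * ((1 : ℤ) : ℂ)) ^ δ *
      ∑ n ∈ (Atar j).support, (if n 0 + n 1 = δ then coeff n (Atar j) else 0) := fun j => rfl
  have h0 : exp ρs.1 = P 0 +
      (fun j i => (F j).coeff i) 0 (e - 1) * exp ((e : ℂ) * (c + (r₀ : ℂ) * ρs.1 +
        ((1 / (e : ℝ) - r₀ : ℝ) : ℂ) * ρs.2)) := by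
    rw [hl0, hconv]
  have h1 : exp ρs.2 = P 1 +
      (fun j i => (F j).coeff i) 1 (e - 1) * exp ((e : ℂ) * (c + (r₀ : ℂ) * ρs.1 +
        ((1 / (e : ℝ) - r₀ : ℝ) : ℂ) * ρs.2)) := by
    rw [hl1, hconv]
  have hdet : ((1 / (e : ℝ) - r₀ : ℝ) : ℂ) * P 1 * exp ρs.1 + (r₀ : ℂ) * P 0 * exp ρs.2 ≠ 0 := by
    intro h
    apply hnd
    have : (1 - (α : ℂ)) * P 1 * exp ρs.1 + (α : ℂ) * P 0 * exp ρs.2 =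
        (e : ℂ) * (((1 / (e : ℝ) - r₀ : ℝ) : ℂ) * P 1 * exp ρs.1 + (r₀ : ℂ) * P 0 * exp ρs.2) := by
      rw [hα]; push_cast; field_simp
    rw [this, h, mul_zero]
  obtain ⟨x, ρ, hρ, hx0, hx1, hsol⟩ :=
    exists_solutions_criticalTargets e δ he hδ Atar htot (fun j i => (F j).coeff i) r₀ c (p := 1)
      one_ne_zero P hPform h0 h1 hdet
  set P3 : ℕ → Fin 3 ⊕ Fin 3 → ℂ := fun m =>
    pgParam (hyperplanePoly r c) Atar (fun j => (F j).toMvPolynomial 0)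
      (x m) (exp (∑ i, (r i : ℂ) * x m i + c)) with hP3
  have hρ1 : Tendsto (fun m => (ρ m).1) atTop (𝓝 ρs.1) := (continuous_fst.tendsto _).comp hρ
  have hρ2 : Tendsto (fun m => (ρ m).2) atTop (𝓝 ρs.2) := (continuous_snd.tendsto _).comp hρ
  have hs0 : Tendsto (fun m : ℕ => (((1 / (m : ℝ) : ℝ)) : ℂ)) atTop (𝓝 0) := by
    have h := (continuous_ofReal.tendsto (0 : ℝ)).comp tendsto_one_div_atTop_nhds_zero_nat
    rw [ofReal_zero] at h
    exact h
  have hl0' : Tendsto (fun m : ℕ => (((Real.log m / (m : ℝ) : ℝ)) : ℂ)) atTop (𝓝 0) := by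
    have h := (continuous_ofReal.tendsto (0 : ℝ)).comp
      (tendsto_log_pow_div_natCast_comp (d := fun m => m) tendsto_id 1)
    rw [ofReal_zero] at h
    refine h.congr fun m => ?_
    simp only [Function.comp_apply, pow_one]
  -- the solution property in the shape of `pgParam_hyperplane_mem_expGraph`
  have hsolW : ∀ᶠ m in atTop, ∀ j : Fin 2, exp (x m j) = eval (x m) (Atar j) +
      exp (∑ i, (r i : ℂ) * x m i + c) * (F j).eval (exp (∑ i, (r i : ℂ) * x m i + c)) := by
    filter_upwards [hsol] with m hm j
    rw [Polynomial.eval_eq_sum_range' (hdegj j), hm j]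
  refine ⟨P3, fun m => (m : ℝ), ?_, tendsto_natCast_atTop_atTop, ?_, ?_, ?_⟩
  · filter_upwards [hsolW] with m hm
    exact ⟨pgParam_mem _ _ _ _ _, pgParam_hyperplane_mem_expGraph r c Atar F hm⟩
  · -- `x₁ - x₀ → ρ₁* - ρ₀*`
    have hlim : Tendsto (fun m => (ρ m).2 - (ρ m).1) atTop (𝓝 (ρs.2 - ρs.1)) := hρ2.sub hρ1
    refine hlim.congr fun m => ?_
    have e0 : (Sum.inl 0 : Fin 3 ⊕ Fin 3) = Sum.inl (Fin.castSucc (0 : Fin 2)) := rfl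
    have e1 : (Sum.inl 1 : Fin 3 ⊕ Fin 3) = Sum.inl (Fin.castSucc (1 : Fin 2)) := rfl
    simp only [hP3, Matrix.cons_val_one, Matrix.cons_val_zero, e0, e1, pgParam_inl_castSucc,
      hx0 m, hx1 m]
    ring
  · -- `x₀ / m → 2πi e`
    have hlim : Tendsto (fun m : ℕ => 2 * Real.pi * I * (e : ℂ) +
        (δ : ℂ) * (((Real.log m / (m : ℝ) : ℝ)) : ℂ) + (ρ m).1 * (((1 / (m : ℝ) : ℝ)) : ℂ)) atTop
        (𝓝 (2 * Real.pi * I * (e : ℂ) + (δ : ℂ) * 0 + ρs.1 * 0)) :=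
      (tendsto_const_nhds.add (tendsto_const_nhds.mul hl0')).add (hρ1.mul hs0)
    simp only [add_zero, mul_zero] at hlim
    refine hlim.congr' ?_
    filter_upwards [eventually_ge_atTop 1] with m hm
    have hmC : (m : ℂ) ≠ 0 := by exact_mod_cast (show m ≠ 0 by omega)
    have e0 : (Sum.inl 0 : Fin 3 ⊕ Fin 3) = Sum.inl (Fin.castSucc (0 : Fin 2)) := rfl
    simp only [hP3, Matrix.cons_val_zero, e0, pgParam_inl_castSucc, hx0 m]
    push_cast
    field_simp
  · -- `y₀ / m^δ = e^{x₀}/m^δ = e^{ρ₀(m)} → e^{ρ₀*}`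
    have hlim : Tendsto (fun m => exp (ρ m).1) atTop (𝓝 (exp ρs.1)) :=
      (Complex.continuous_exp.tendsto _).comp hρ1
    refine hlim.congr' ?_
    filter_upwards [hsolW, eventually_ge_atTop 1] with m hm hm1
    have hmpos : (0 : ℝ) < (m : ℝ) := by exact_mod_cast hm1
    have hmC : (m : ℂ) ≠ 0 := by exact_mod_cast (show m ≠ 0 by omega)
    have hexpL : exp ((δ : ℂ) * ((Real.log m : ℝ) : ℂ)) = (m : ℂ) ^ δ := by
      rw [Complex.exp_nat_mul, ← Complex.ofReal_exp, Real.exp_log hmpos]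
      push_cast
      rfl
    have hexpP : exp (2 * Real.pi * I * (e : ℂ) * ((1 : ℤ) : ℂ) * (m : ℂ)) = 1 := by
      have := Complex.exp_int_mul_two_pi_mul_I ((e : ℤ) * m)
      rw [← this]; congr 1; push_cast; ring
    have e0 : (Sum.inr 0 : Fin 3 ⊕ Fin 3) = Sum.inr (Fin.castSucc (0 : Fin 2)) := rfl
    have hcoord : P3 m (Sum.inr 0) = exp (x m 0) := by
      simp only [hP3, e0, pgParam_inr, pMulParam_castSucc]
      rw [hm 0, MvPolynomial.eval_toMvPolynomial, Fin.cons_zero]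
    rw [show (![Sum.inl 0, Sum.inl 1, Sum.inr 0] : Fin 3 → Fin 3 ⊕ Fin 3) 2 = Sum.inr 0 from rfl,
      hcoord, hx0 m, Complex.exp_add, Complex.exp_add, hexpP, one_mul, hexpL]
    push_cast
    field_simp

/-- **Certified members at critical size with degree-`δ` targets, dense.**  With the targets also
DOMINANT (`aeval A` injective): all seven hypotheses of `ECCell 3 2`, not linearly split,
`W ∩ Γ_exp ≠ ∅`, `I(W ∩ Γ_exp) = I(W)`. (new)
[cite: MantovaMasser2023, §1 p.5 (the open case dim π(V) = 2 in ℂ³×ℂˣ³)] -/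
theorem polyFibredGraph_critical_targets_member_dense (δ : ℕ) (hδ : 1 ≤ δ)
    (Atar : Fin 2 → MvPolynomial (Fin 2) ℂ) (htot : ∀ j, (Atar j).totalDegree ≤ δ)
    (htop : ∀ j, (∑ n ∈ (Atar j).support, (if n 0 + n 1 = δ then coeff n (Atar j) else 0)) ≠ 0)
    (hA : Function.Injective (aeval Atar : MvPolynomial (Fin 2) ℂ →ₐ[ℂ] MvPolynomial (Fin 2) ℂ))
    (F : Fin 2 → Polynomial ℂ) (hF0 : F 0 ≠ 0) (hdeg : (F 1).natDegree ≤ (F 0).natDegree)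
    (r₀ : ℝ) (hr : Irrational r₀) (c : ℂ) :
    let W := polyFibredGraph (hyperplanePoly ![r₀, 1 / (((F 0).natDegree + 1 : ℕ) : ℝ) - r₀] c)
      Atar (fun j => (F j).toMvPolynomial 0)
    (IsIrreducibleClosed ℂ W ∧ (W ∩ torusLocus ℂ 3).Nonempty ∧ IsRotund ℂ 3 (W ∩ torusLocus ℂ 3) ∧
        IsAddFree ℂ 3 (W ∩ torusLocus ℂ 3) ∧ IsMulFree ℂ 3 (W ∩ torusLocus ℂ 3) ∧
        zariskiDim ℂ W = (3 : ℕ) ∧ addProjDim ℂ 3 W = (2 : ℕ)) ∧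
      ¬ IsLinearSplit ℂ 3 W ∧ (W ∩ expGraph ℂ 3).Nonempty ∧ UnprojectedDense W := by
  intro W
  have hirr : ∃ i : Fin 2, Irrational
      ((![r₀, 1 / (((F 0).natDegree + 1 : ℕ) : ℝ) - r₀] : Fin 2 → ℝ) i) := ⟨0, by simpa using hr⟩
  have hcell := ecCell_hypotheses_polyFibredGraph_hyperplane
    ![r₀, 1 / (((F 0).natDegree + 1 : ℕ) : ℝ) - r₀] c Atar (fun j => (F j).toMvPolynomial 0) hA hirr
  have hdense := unprojectedDense_polyFibredGraph_critical_targets δ hδ Atar htot htop F hF0 hdeg r₀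
    hr c
  refine ⟨hcell, not_isLinearSplit_polyFibredGraph _ Atar _ (by norm_num) hA, ?_, hdense⟩
  obtain ⟨w, hw, -⟩ := hcell.2.1
  exact inter_expGraph_nonempty_of_vanishingIdeal_eq ⟨w, hw⟩ hdense

/-- The targets `(x₀², x₁²)` are dominant: `aeval (X₀², X₁²) = expand 2` is injective. [folklore] -/
theorem aeval_sq_targets_injective :
    Function.Injective (aeval (![X 0 ^ 2, X 1 ^ 2] : Fin 2 → MvPolynomial (Fin 2) ℂ) :
      MvPolynomial (Fin 2) ℂ →ₐ[ℂ] MvPolynomial (Fin 2) ℂ) := by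
  have h : (aeval (![X 0 ^ 2, X 1 ^ 2] : Fin 2 → MvPolynomial (Fin 2) ℂ) :
      MvPolynomial (Fin 2) ℂ →ₐ[ℂ] MvPolynomial (Fin 2) ℂ) = expand 2 := by
    refine MvPolynomial.algHom_ext fun i => ?_
    rw [aeval_X, expand_X]
    fin_cases i <;> simp
  rw [h]
  exact expand_injective two_pos

/-- **Quadratic targets at critical size are dense**:
`W = {x₂ = √2x₀ + (1/2 - √2)x₁, y₀ = x₀² + y₂², y₁ = x₁² + 2y₂²}` (`δ = 2`, `Aⱼ = xⱼ²`, `F = (u, 2u)`,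
`e = 2`): all seven hypotheses of `ECCell 3 2`, not linearly split, `W ∩ Γ_exp ≠ ∅`,
`I(W ∩ Γ_exp) = I(W)`. (new) [cite: MantovaMasser2023, §1 p.5 (the open case dim π(V) = 2 in ℂ³×ℂˣ³)] -/
theorem sqSqTargets_member_dense :
    let F : Fin 2 → Polynomial ℂ := ![Polynomial.X, Polynomial.C 2 * Polynomial.X]
    let W := polyFibredGraph (hyperplanePoly ![Real.sqrt 2,
        1 / (((F 0).natDegree + 1 : ℕ) : ℝ) - Real.sqrt 2] 0) (![X 0 ^ 2, X 1 ^ 2])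
      (fun j => (F j).toMvPolynomial 0)
    (IsIrreducibleClosed ℂ W ∧ (W ∩ torusLocus ℂ 3).Nonempty ∧ IsRotund ℂ 3 (W ∩ torusLocus ℂ 3) ∧
        IsAddFree ℂ 3 (W ∩ torusLocus ℂ 3) ∧ IsMulFree ℂ 3 (W ∩ torusLocus ℂ 3) ∧
        zariskiDim ℂ W = (3 : ℕ) ∧ addProjDim ℂ 3 W = (2 : ℕ)) ∧
      ¬ IsLinearSplit ℂ 3 W ∧ (W ∩ expGraph ℂ 3).Nonempty ∧ UnprojectedDense W := by
  classical
  refine polyFibredGraph_critical_targets_member_dense 2 (by norm_num) ![X 0 ^ 2, X 1 ^ 2] ?_ ?_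
    aeval_sq_targets_injective ![Polynomial.X, Polynomial.C 2 * Polynomial.X] (by simp) ?_
    (Real.sqrt 2) irrational_sqrt_two 0
  · intro j
    fin_cases j <;> simp [totalDegree_X_pow]
  · intro j
    fin_cases j <;>
      simp [support_X_pow, coeff_X_pow]
  · simp only [Matrix.cons_val_one, Matrix.cons_val_zero, Polynomial.natDegree_X]
    exact (Polynomial.natDegree_C_mul_le _ _).trans (by simp)

end TargetsDensity

end Summit.Schanuel.Schanuel.Theorems

end
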